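import Summits.HodgeConjecture.HodgeConjecture.Theorems.PadicSemiregularLiftFermatAnchorAssemblyGMFFieldExtension
import Summits.HodgeConjecture.HodgeConjecture.Theorems.PadicSemiregularLiftFermatAnchorAssemblyStubReadout
import Literature.FieldTheory.AlgClosed.EmbeddingIntoComplex

/-!
# `stub_readoutCore`, step (0) completed: WLOG `K = ℂ` (line `witt-lift-rigid-mf`)

Crux `FermatAnchorAssembly` (stmt-HodgeConjecture-14874), route `PadicSemiregularLift` of `HodgeConjecture`,
line `witt-lift-rigid-mf`, stub `stub_readoutCore` (the categorical core of the characteristic-zero readout,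
skeleton `Cruxes/FermatAnchorAssembly/Lines/witt_lift_rigid_mf.lean`, statement `ReadoutCoreStatement`).
The stub quantifies over an ARBITRARY field `K ⊇ ℚ` (the characteristic-zero model produced by L2,
`stub_eulerBaseChange`, lives over an abstract `W(𝕜)[1/p]`-like field), while its printed proof (Orlov,
HRR for `HMF^gr`, HKR, Chern classes algebraic) is run over `ℂ`. Step (0) of the printed proof is the
LEFSCHETZ PRINCIPLE; its "up" half (invariance of `homDim`, `IsRigid`, `eulerForm`, `thetaPoly` under a
field map `σ : K →+* K'`) is `…GMFFieldExtension` (p163731); the embedding `K₀ ↪ ℂ` of a countably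
generated field of characteristic `0` is `Literature/FieldTheory/AlgClosed/EmbeddingIntoComplex.lean`
(p166812). This file supplies the "down" half and the assembled reduction, sorry-free and definition-free:

* `exists_map_subtype_eq_of_coeffs_subset` — a polynomial with coefficients in a subfield `K₀` comes from
  `K₀` (Mathlib `MvPolynomial.mem_range_map_iff_coeffs_subset`);
* `GMF.exists_descent` — DESCENT: a lawful `L`-graded factorization `N` over a field `K` whose
  coefficients lie in `K₀` is the base change `N₀ ⊗_{K₀} K` of a lawful `N₀` over `K₀` (entries restricted
  coefficientwise; the axioms — bihomogeneity, `φψ = ψφ = (Σ xᵢᵐ)·1` — are identities of polynomial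
  matrices, pulled back along the injective `Matrix.map (MvPolynomial.map K₀.subtype)`);
* `readout_descent_invariants` — ∀-form: the descended `N₀` is rigid iff `N` is and has the same charge
  polynomial `Θ_{γ,N₀}` (at `ζ ∈ K₀`) as `N` (at `ζ`), by `GMFData.isRigid_map_iff` /
  `GMFData.thetaPoly_map_of_field` along `K₀.subtype`;
* `exists_countable_coeffs_subset` — `ζ` and the coefficients of `N` lie in a countable subset of `K`;
* `readoutCore_of_complex` — **the reduction**: the complex case of `ReadoutCoreStatement` (spelled out;
  no `abbrev` of it is declared here, it would be a restatement of the stub) implies `ReadoutCoreStatement`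
  (verbatim) for every field `K` of characteristic `0`: descend `N` to `K₀ = ℚ(ζ, coefficients)`
  (countably generated), embed `K₀ ↪ ℂ` (`Subfield.nonempty_ringHom_closure_complex`: transcendence bases +
  `IsAlgClosed.lift`), base change along the embedding (`GMF.baseChange`, `GMFData.thetaPoly_map_of_field`;
  primitive roots map to primitive roots along injective maps); the conclusion
  `∃ c ∈ algebraicClasses (X²ʳₘ) r, π_γ c ≠ 0` does not mention `K`.

All `[folklore]`; no definition, no named fact, no hypothesis structure, no `sorry`. Deliberately NOT here:
the complex case itself (Orlov 2009 Thm 2.5, Polishchuk–Vaintrob HRR, BFK Thm 10.26, Căldăraru HKR — no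
carrier in the tree; see `Cruxes/FermatAnchorAssembly/Lines/witt-lift-rigid-mf-readoutCore-blockers-c6.md`).
-/

-- `Summit.HodgeConjecture.HodgeConjecture.…` is the tree's mandated summit/problem namespace (single-problem summit).
set_option linter.dupNamespace false

noncomputable section

open Finset
open Literature.AlgebraicGeometry.HodgeTheory Literature.AlgebraicGeometry.HodgeTheory.FermatCharacter

namespace Summit.HodgeConjecture.HodgeConjecture.Cruxes.FermatAnchorAssembly.WittLiftRigidMf

/-! ### Descent of polynomials and of lawful factorizations to a subfield containing the coefficients -/

section Descent

variable {K : Type} [Field K] {ν m : ℕ}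

/-- A polynomial whose coefficients lie in the subfield `K₀` comes from `K₀`
(Mathlib `MvPolynomial.mem_range_map_iff_coeffs_subset`). [folklore] -/
theorem exists_map_subtype_eq_of_coeffs_subset (K₀ : Subfield K) (q : MvPolynomial (Fin ν) K)
    (hq : ((q.coeffs : Finset K) : Set K) ⊆ K₀) :
    ∃ q₀ : MvPolynomial (Fin ν) K₀, MvPolynomial.map K₀.subtype q₀ = q := by
  have h : q ∈ Set.range (MvPolynomial.map K₀.subtype) := by
    rw [MvPolynomial.mem_range_map_iff_coeffs_subset]
    intro x hx
    exact ⟨⟨x, hq hx⟩, rfl⟩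
  exact h

variable {L : AddSubgroup (Fin ν → ZMod m)} {ι₀ ι₁ : Type} [Fintype ι₀] [Fintype ι₁] [DecidableEq ι₀]
  [DecidableEq ι₁]

/-- **Descent of a lawful `L`-graded factorization to a subfield containing its coefficients** (the
"down" half of the Lefschetz principle): if all coefficients of all entries of `φ` and `ψ` lie in
`K₀ ≤ K`, there is a lawful `N₀` over `K₀` with `N₀ ⊗_{K₀} K = N` on data. The entries are restricted
coefficientwise; bihomogeneity only constrains supports, which `MvPolynomial.map K₀.subtype` preserves
(injective); the identities `φψ = ψφ = (Σ xᵢᵐ)·1` pull back along the injective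
`Matrix.map (MvPolynomial.map K₀.subtype)`. [folklore] -/
theorem GMF.exists_descent (K₀ : Subfield K) (N : GMF K ν m L ι₀ ι₁)
    (hNφ : ∀ i j, (((N.φ i j).coeffs : Finset K) : Set K) ⊆ K₀)
    (hNψ : ∀ j i, (((N.ψ j i).coeffs : Finset K) : Set K) ⊆ K₀) :
    ∃ N₀ : GMF K₀ ν m L ι₀ ι₁, N₀.toGMFData.map K₀.subtype = N.toGMFData := by
  obtain ⟨⟨d₀, d₁, c₀, c₁, φ, ψ⟩, hφb, hψb, hφψ, hψφ⟩ := N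
  -- restrict every entry to `K₀`
  choose φ₀ hφ₀ using fun i j ↦ exists_map_subtype_eq_of_coeffs_subset K₀ (φ i j) (hNφ i j)
  choose ψ₀ hψ₀ using fun j i ↦ exists_map_subtype_eq_of_coeffs_subset K₀ (ψ j i) (hNψ j i)
  have hval : Function.Injective (K₀.subtype : K₀ → K) := Subtype.val_injective
  have hinj : Function.Injective (MvPolynomial.map (σ := Fin ν) K₀.subtype) :=
    MvPolynomial.map_injective _ hval
  have hφ : (Matrix.of φ₀).map (MvPolynomial.map K₀.subtype) = φ := Matrix.ext fun i j ↦ hφ₀ i j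
  have hψ : (Matrix.of ψ₀).map (MvPolynomial.map K₀.subtype) = ψ := Matrix.ext fun j i ↦ hψ₀ j i
  refine ⟨{ d₀ := d₀, d₁ := d₁, c₀ := c₀, c₁ := c₁, φ := Matrix.of φ₀, ψ := Matrix.of ψ₀,
            φ_bihom := fun i j ↦ (hφb i j).of_support_subset (by
              change (φ₀ i j).support ⊆ (φ i j).support
              rw [← hφ₀ i j, MvPolynomial.support_map_of_injective _ hval]),
            ψ_bihom := fun j i ↦ (hψb j i).of_support_subset (by
              change (ψ₀ j i).support ⊆ (ψ j i).support
              rw [← hψ₀ j i, MvPolynomial.support_map_of_injective _ hval]),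
            φ_mul_ψ := by
              apply Matrix.map_injective hinj
              change (Matrix.of φ₀ * Matrix.of ψ₀).map (MvPolynomial.map K₀.subtype) =
                (fermatForm K₀ ν m • (1 : Matrix ι₀ ι₀ _)).map (MvPolynomial.map K₀.subtype)
              rw [Matrix.map_mul, hφ, hψ, smul_one_map, map_fermatForm]
              exact hφψ,
            ψ_mul_φ := by
              apply Matrix.map_injective hinj
              change (Matrix.of ψ₀ * Matrix.of φ₀).map (MvPolynomial.map K₀.subtype) =
                (fermatForm K₀ ν m • (1 : Matrix ι₁ ι₁ _)).map (MvPolynomial.map K₀.subtype)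
              rw [Matrix.map_mul, hφ, hψ, smul_one_map, map_fermatForm]
              exact hψφ }, ?_⟩
  change (GMFData.mk d₀ d₁ c₀ c₁ ((Matrix.of φ₀).map (MvPolynomial.map K₀.subtype))
    ((Matrix.of ψ₀).map (MvPolynomial.map K₀.subtype)) : GMFData K ν m ι₀ ι₁) = GMFData.mk d₀ d₁ c₀ c₁ φ ψ
  rw [hφ, hψ]

end Descent

/-! ### Registered-style sub-goal (∀-form): descent keeps rigidity and the charge polynomial -/

/-- **Sub-goal (∀-form): the "down" half of the Lefschetz principle for the readout.** For a field `K`, a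
subfield `K₀`, `ζ ∈ K₀` with `ζᵐ = 1` and a lawful `L`-graded factorization `N` of `Σ_{i<ν} xᵢᵐ` over `K`
all of whose coefficients lie in `K₀`, there is a lawful `N₀` over `K₀` with `N₀ ⊗_{K₀} K = N` on data,
rigid iff `N` is (`GMFData.isRigid_map_iff`), and with the same charge polynomial at `ζ ∈ K₀` as `N` at `ζ`
(`GMFData.thetaPoly_map_of_field` along `K₀.subtype`). [folklore] -/
theorem readout_descent_invariants : ∀ (K : Type) [Field K] (K₀ : Subfield K) (ν m : ℕ) [NeZero m]
    (L : AddSubgroup (Fin ν → ZMod m)) (ι₀ ι₁ : Type) [Fintype ι₀] [Fintype ι₁] [DecidableEq ι₀]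
    [DecidableEq ι₁] (ζ : K) (hζ : ζ ∈ K₀), ζ ^ m = 1 → ∀ (γ : Fin ν → ZMod m) (N : GMF K ν m L ι₀ ι₁),
    (∀ i j, (((N.φ i j).coeffs : Finset K) : Set K) ⊆ K₀) →
    (∀ j i, (((N.ψ j i).coeffs : Finset K) : Set K) ⊆ K₀) →
    ∃ N₀ : GMF K₀ ν m L ι₀ ι₁, N₀.toGMFData.map K₀.subtype = N.toGMFData ∧
      (GMFData.IsRigid K₀ L N₀.toGMFData ↔ GMFData.IsRigid K L N.toGMFData) ∧
      GMFData.thetaPoly K₀ L (⟨ζ, hζ⟩ : K₀) γ N₀.toGMFData = GMFData.thetaPoly K L ζ γ N.toGMFData := by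
  intro K _ K₀ ν m _ L ι₀ ι₁ _ _ _ _ ζ hζ hζm γ N hNφ hNψ
  obtain ⟨N₀, hN₀⟩ := GMF.exists_descent K₀ N hNφ hNψ
  have hζ₀ : (⟨ζ, hζ⟩ : K₀) ^ m = 1 := Subtype.ext (by simpa using hζm)
  refine ⟨N₀, hN₀, ?_, ?_⟩
  · rw [← GMFData.isRigid_map_iff K₀.subtype N₀, hN₀]
  · rw [← GMFData.thetaPoly_map_of_field K₀.subtype hζ₀ γ N₀, hN₀]
    rfl

/-! ### The reduction of `stub_readoutCore` to the complex case -/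

/-- `ζ` and the (finitely many) coefficients of all entries of `φ`, `ψ` lie in a countable subset of `K`.
[folklore] -/
theorem exists_countable_coeffs_subset {K : Type} [Field K] {ν m : ℕ} {ι₀ ι₁ : Type} [Finite ι₀]
    [Finite ι₁] (ζ : K) (N : GMFData K ν m ι₀ ι₁) :
    ∃ S : Set K, S.Countable ∧ ζ ∈ S ∧ (∀ i j, (((N.φ i j).coeffs : Finset K) : Set K) ⊆ S) ∧
      ∀ j i, (((N.ψ j i).coeffs : Finset K) : Set K) ⊆ S := by
  refine ⟨insert ζ ((⋃ i, ⋃ j, (((N.φ i j).coeffs : Finset K) : Set K)) ∪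
      ⋃ j, ⋃ i, (((N.ψ j i).coeffs : Finset K) : Set K)), ?_, Set.mem_insert _ _, fun i j x hx ↦ ?_,
    fun j i x hx ↦ ?_⟩
  · refine (Set.Finite.insert ζ (Set.Finite.union ?_ ?_)).countable
    · exact Set.finite_iUnion fun i ↦ Set.finite_iUnion fun j ↦ (N.φ i j).coeffs.finite_toSet
    · exact Set.finite_iUnion fun j ↦ Set.finite_iUnion fun i ↦ (N.ψ j i).coeffs.finite_toSet
  · exact Set.mem_insert_of_mem _ (Or.inl (Set.mem_iUnion.2 ⟨i, Set.mem_iUnion.2 ⟨j, hx⟩⟩))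
  · exact Set.mem_insert_of_mem _ (Or.inr (Set.mem_iUnion.2 ⟨j, Set.mem_iUnion.2 ⟨i, hx⟩⟩))

/-- **`stub_readoutCore`, WLOG `K = ℂ`** (step (0) of its printed proof, the Lefschetz principle,
completed): the COMPLEX CASE of the skeleton's `ReadoutCoreStatement` (the hypothesis: `ReadoutCoreStatement`
with `K := ℂ`, spelled out — for `0 < r`, `Σ γᵢ = 0`, all `γᵢ ≠ 0`, a primitive `m`-th root `ζ ∈ ℂ` and a
lawful `L`-graded factorization `N` of `Σ_{i<2r+2} xᵢᵐ` over `ℂ` with `Φₘ ∤ Θ_{γ,N}`, some class in the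
`ℂ`-span of the codimension-`r` algebraic cycles of `X²ʳₘ` has `π_γ c ≠ 0`; in print: Orlov's theorem, HRR
for `HMF^gr`, HKR, Chern classes algebraic) implies `ReadoutCoreStatement` (the conclusion, verbatim) for
EVERY field `K` of characteristic `0`. Proof: `ζ` and the finitely many coefficients of `N` lie in a
countable `S ⊆ K` (`exists_countable_coeffs_subset`); descend the lawful `N` to `K₀ = Subfield.closure S`
keeping `Θ` (`readout_descent_invariants`); `K₀` embeds into `ℂ` (`Subfield.nonempty_ringHom_closure_complex`);
base change along the embedding `σ` keeps `N₀` lawful (`GMF.baseChange`) with the same `Θ` at the primitive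
root `σ ζ` (`GMFData.thetaPoly_map_of_field`, `IsPrimitiveRoot.map_of_injective`); apply the complex case —
its conclusion does not mention `K`. [folklore] -/
theorem readoutCore_of_complex :
    (∀ (m r : ℕ) [NeZero m] (ζ : ℂ), IsPrimitiveRoot ζ m →
      ∀ (γ : Fin (2 * r + 2) → ZMod m), (∀ i, γ i ≠ 0) → 0 < r → ∑ i, γ i = 0 →
      ∀ (ι₀ ι₁ : Type) [Fintype ι₀] [Fintype ι₁] [DecidableEq ι₀] [DecidableEq ι₁]
        (L : AddSubgroup (Fin (2 * r + 2) → ZMod m)) (N : GMF ℂ (2 * r + 2) m L ι₀ ι₁),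
        ¬ (Polynomial.cyclotomic m ℤ ∣ GMFData.thetaPoly ℂ L ζ γ N.toGMFData) →
        ∃ c ∈ algebraicClasses (fermatHypersurface (2 * r) m) r, fermatProjector m γ (2 * r) c ≠ 0) →
    ∀ (m r : ℕ) [NeZero m] (K : Type) [Field K] [CharZero K] (ζ : K), IsPrimitiveRoot ζ m →
    ∀ (γ : Fin (2 * r + 2) → ZMod m), (∀ i, γ i ≠ 0) → 0 < r → ∑ i, γ i = 0 →
    ∀ (ι₀ ι₁ : Type) [Fintype ι₀] [Fintype ι₁] [DecidableEq ι₀] [DecidableEq ι₁]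
      (L : AddSubgroup (Fin (2 * r + 2) → ZMod m)) (N : GMF K (2 * r + 2) m L ι₀ ι₁),
      ¬ (Polynomial.cyclotomic m ℤ ∣ GMFData.thetaPoly K L ζ γ N.toGMFData) →
      ∃ c ∈ algebraicClasses (fermatHypersurface (2 * r) m) r, fermatProjector m γ (2 * r) c ≠ 0 := by
  intro hC m r _ K _ _ ζ hζ γ hγ hr hs ι₀ ι₁ _ _ _ _ L N hΘ
  -- (1) descent to `K₀ = Subfield.closure S ∋ ζ, coefficients of N`
  obtain ⟨S, hSc, hζS, hφS, hψS⟩ := exists_countable_coeffs_subset ζ N.toGMFData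
  have hζ₀ : ζ ∈ Subfield.closure S := Subfield.subset_closure hζS
  obtain ⟨N₀, -, -, hΘ₀⟩ := readout_descent_invariants K (Subfield.closure S) (2 * r + 2) m L ι₀ ι₁ ζ hζ₀
    hζ.pow_eq_one γ N (fun i j ↦ (hφS i j).trans Subfield.subset_closure)
    (fun j i ↦ (hψS j i).trans Subfield.subset_closure)
  have hprim₀ : IsPrimitiveRoot (⟨ζ, hζ₀⟩ : Subfield.closure S) m :=
    IsPrimitiveRoot.coe_submonoidClass_iff.mp hζ
  -- (2) `K₀` embeds into `ℂ`
  obtain ⟨σ⟩ := Subfield.nonempty_ringHom_closure_complex hSc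
  -- (3) base change along `σ` and the complex case
  refine hC m r (σ ⟨ζ, hζ₀⟩) (hprim₀.map_of_injective σ.injective) γ hγ hr hs ι₀ ι₁ L
    (N₀.baseChange σ) ?_
  rw [GMF.baseChange_toGMFData, GMFData.thetaPoly_map_of_field σ hprim₀.pow_eq_one γ N₀, hΘ₀]
  exact hΘ

end Summit.HodgeConjecture.HodgeConjecture.Cruxes.FermatAnchorAssembly.WittLiftRigidMf

end
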